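import Summits.AnomalousDissipation.AnomalousDissipation.Theorems.UniformResolution.Negative.RowBarrierLeakLaw
import Summits.AnomalousDissipation.AnomalousDissipation.Theorems.UniformResolution.Negative.Shape
import Summits.AnomalousDissipation.AnomalousDissipation.Theorems.MomentParityUniformResolutionTightness

/-!
# Negative knowledge for the crux `UniformResolution` (stmt-AnomalousDissipation-14330), X-c:
# the ROW BARRIER — the energy row and the Foias–Guillopé–Temam row carry no uniform integrability

Standing disprover, generation 2 (refuter-cdisprove-stmt-AnomalousDissipation-14330-g2-0, cycle 1). Supports
stmt-AnomalousDissipation-14330 (`QuarticLadder.UniformResolution` ≡ `MomentParity.UniformResolution`); NO route-item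
statement is asserted positively (the two `def … : Prop` below are WEAKENINGS-TO-REFUTE, each negated here).

WHAT IS REFUTED. The live line `Sketch` (lead c15) reduces the crux to S4 `stub_loudUI` = UNIFORM INTEGRABILITY of the
enstrophy over a loud family of Galerkin-invariant level-`N` laws at fixed `ν`, and the information it has IN HAND about
such a family is exactly: the ENERGY ROW (test field `ū = P_N u`: `ν E‖∇ū‖² = E∫⟪f,ū⟫`, whence the `N`-uniform MEAN
enstrophy bound) and the FGT ROW (test field `(1+‖∇ū‖²)⁻⁴(−Δū)`, S3 `stub_weightedH2`: the `N`-uniform weighted `H²`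
bound, whence tightness in probability of the enstrophy spectrum). These two rows — even satisfied EXACTLY, together
with loudness, a common support ball, level-`N` carriers and a common mean-enstrophy bound — give NEITHER uniform
integrability NOR resolution by any schedule `κ`: the explicit leak laws of `Negative/RowBarrierLeakLaw.lean` satisfy all
of it (`rowBarrier`), while (`not_uniformlyIntegrableEnstrophy_leakLaw`) a fixed quantum `π²/4` of mean enstrophy sits on
the cutoff shell `|k| = m + 2` with mass `(8(m+2)²)⁻¹` and (`not_isResolved_leakLaw`) escapes every `P_{κ 0}`.

* `rowBarrier` (data form), `not_rowsForceUniformIntegrability`, `not_rowsForceResolution` (the per-family upgrades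
  "energy row ∧ FGT row ∧ loud ∧ ball ∧ level ⟹ UI / resolved" are FALSE); `tight_not_uniformlyIntegrable_leakLaw`: the
  leak family IS tight in probability (landed `tight_in_probability`, p89892) with the weighted `H²` bound and a common mean
  bound — the gap between tightness in probability and S4 is real.

CONSEQUENCE FOR THE LINE. Any proof of S4 (⟺ the crux, by the landed necessity p89716 and the skeleton's sufficiency)
must use stationarity rows on which the inertial term `B(u,u)` is visible and NOT absorbed: on shear atoms every
inertial pairing vanishes, so the leak laws satisfy exactly the Stokes part of the two rows; the rows that WOULD force
resolution here (the plain enstrophy row `Ψ = ‖∇ū‖²`, bounding `E‖Δū‖²`; its square) are those whose stretching term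
`E∫⟪(ū·∇)ū, Δū⟫` is the open superlinear closure. Complement (not formalised, two lines): with NON-interacting atoms the
LINEAR rows plus the energy row already force laminarity (`E‖∇u‖² ≥ ‖∇ū_mean‖²` = input, Jensen), which is why the
barrier keeps the energy row and drops the linear ones (cf. gen-1's `not_uniformResolutionMeanRowOnly`: linear rows only,
zero force).
-/

namespace Summit.AnomalousDissipation.AnomalousDissipation.Theorems.UniformResolution.Negative

open MeasureTheory Filter Topology
open scoped ENNReal InnerProductSpace RealInnerProductSpace
open Literature.Analysis.FunctionSpaces Literature.Analysis.FluidPDE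
open Summit.AnomalousDissipation.AnomalousDissipation.Theorems.QuarticGate.Negative
open Summit.AnomalousDissipation.AnomalousDissipation.Theorems
open Summit.AnomalousDissipation.AnomalousDissipation.Theorems.ResolvedDissipation.Negative
  (shearFreq shearSet shearField shearState shearField_mul shearField_zero neg_mem_shearSet freqNormSq_of_mem_shearSet
    ne_zero_of_mem_shearSet card_shearSet isSmooth_shearField isDivFree_shearField hasZeroMean_shearField
    convect_shearField_self coe_shearState_ae isLevel_shearState norm_sq_shearState eGradNormSq_shearState
    eGradNormSq_fourierTruncate_shearState mFourierCoeff_shearField_eq_zero integral_norm_sq_shearField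
    isTransversal_kolCoeff_shearSet fourierTruncate_shearField eGradNormSq_zero fourierTruncate_congr_ae)

noncomputable section

/-- Local notation for the real Hilbert space `L²(T³; ℝ³)`. -/
local notation "L2T3" => Lp (EuclideanSpace ℝ (Fin 3)) 2 (volume : Measure (UnitAddTorus (Fin 3)))

section Barrier

/-! ### The leak: no uniform integrability, no resolution -/

/-- The enstrophy carried beyond any threshold `L < 2π²(m+2)²` is at least the cutoff quantum `π²/4`. [folklore] -/
theorem lintegral_tail_leakLaw_ge (m : ℕ) {L : ℝ≥0∞} (hL : L < ENNReal.ofReal (2 * Real.pi ^ 2 * ((m + 2 : ℕ) : ℝ) ^ 2)) :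
    ENNReal.ofReal (Real.pi ^ 2 / 4) ≤
      ∫⁻ u in {u : Torus.energySpace (Fin 3) |
          L < Torus.eGradNormSq ((u.1 : L2T3) : UnitAddTorus (Fin 3) → EuclideanSpace ℝ (Fin 3))},
        Torus.eGradNormSq ((u.1 : L2T3) : UnitAddTorus (Fin 3) → EuclideanSpace ℝ (Fin 3)) ∂(leakLaw m) := by
  set s : Set (Torus.energySpace (Fin 3)) := {u | L < Torus.eGradNormSq ((u.1 : L2T3) : UnitAddTorus (Fin 3) →
    EuclideanSpace ℝ (Fin 3))} with hs
  set G : Torus.energySpace (Fin 3) → ℝ≥0∞ := fun u =>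
    Torus.eGradNormSq ((u.1 : L2T3) : UnitAddTorus (Fin 3) → EuclideanSpace ℝ (Fin 3)) with hG
  have hsm : MeasurableSet s := measurableSet_lt measurable_const Torus.measurable_eGradNormSq_coe
  have e2 := (eGradNormSq_leakAtom m).2.2.1
  rw [← lintegral_indicator hsm, leakLaw, lintegral_atomic]
  have h2 : leakAtom m 2 ∈ s := by
    change L < G (leakAtom m 2)
    rw [hG]
    dsimp only
    rw [e2]
    exact hL
  calc ENNReal.ofReal (Real.pi ^ 2 / 4) = ENNReal.ofReal (leakWeight m 2) * s.indicator G (leakAtom m 2) := by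
        rw [Set.indicator_of_mem h2, hG]
        dsimp only
        rw [e2, ← ENNReal.ofReal_mul (leakWeight_nonneg m 2)]
        congr 1
        simp only [leakWeight, Matrix.cons_val]
        linear_combination (-(2 * Real.pi ^ 2)) * leakMassB_mul_sq m
    _ ≤ ∑ i, ENNReal.ofReal (leakWeight m i) * s.indicator G (leakAtom m i) :=
        Finset.single_le_sum (f := fun i => ENNReal.ofReal (leakWeight m i) * s.indicator G (leakAtom m i))
          (fun _ _ => zero_le) (Finset.mem_univ 2)

/-- **THE LEAK FAMILY IS NOT UNIFORMLY INTEGRABLE IN ENSTROPHY** (any family containing every leak law). [folklore] -/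
theorem not_uniformlyIntegrableEnstrophy_leakLaw {𝓕 : Set (Measure (Torus.energySpace (Fin 3)))}
    (h𝓕 : ∀ m : ℕ, leakLaw m ∈ 𝓕) : ¬ UniformlyIntegrableEnstrophy 𝓕 := by
  intro hUI
  have hη : (0 : ℝ≥0∞) < ENNReal.ofReal (Real.pi ^ 2 / 8) := ENNReal.ofReal_pos.2 (by positivity)
  obtain ⟨L, hL, hUI⟩ := hUI _ hη
  -- a level beyond the threshold
  obtain ⟨m, hm⟩ := exists_nat_gt (L.toReal)
  have hLm : L < ENNReal.ofReal (2 * Real.pi ^ 2 * ((m + 2 : ℕ) : ℝ) ^ 2) := by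
    rw [← ENNReal.ofReal_toReal hL]
    refine (ENNReal.ofReal_lt_ofReal_iff (by positivity)).2 ?_
    have h9 := pi_sq_gt_nine
    have hN : (m : ℝ) + 2 = ((m + 2 : ℕ) : ℝ) := by push_cast; ring
    have hm0 : (0 : ℝ) ≤ m := Nat.cast_nonneg m
    calc L.toReal < m := hm
      _ ≤ ((m : ℝ) + 2) ^ 2 := by nlinarith
      _ ≤ 2 * Real.pi ^ 2 * ((m : ℝ) + 2) ^ 2 := by nlinarith [sq_nonneg ((m : ℝ) + 2)]
      _ = 2 * Real.pi ^ 2 * ((m + 2 : ℕ) : ℝ) ^ 2 := by rw [hN]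
  have h1 := (lintegral_tail_leakLaw_ge m hLm).trans (hUI _ (h𝓕 m))
  rw [ENNReal.ofReal_le_ofReal_iff (by positivity)] at h1
  have hpi : 0 < Real.pi ^ 2 := by positivity
  linarith

/-- Truncation below the cutoff shell: the cutoff atom disappears, the low atoms do not grow. [folklore] -/
theorem lintegral_eGradNormSq_fourierTruncate_leakLaw_le (m : ℕ) {K : ℕ} (hK : K < m + 2) :
    ∫⁻ u, Torus.eGradNormSq (Torus.fourierTruncate K ((u.1 : L2T3) : UnitAddTorus (Fin 3) → EuclideanSpace ℝ (Fin 3)))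
        ∂(leakLaw m) ≤
      ENNReal.ofReal (leakMassA m * (Real.pi ^ 2 / 2) + leakMassC m * (Real.pi ^ 2 / 8)) := by
  rw [leakLaw, lintegral_atomic]
  -- atomwise bounds for the level-1 atoms
  have hlow : ∀ (a : ℝ), Torus.eGradNormSq (Torus.fourierTruncate K (((shearState 1 one_ne_zero a).1 : L2T3) :
      UnitAddTorus (Fin 3) → EuclideanSpace ℝ (Fin 3))) ≤ ENNReal.ofReal (2 * Real.pi ^ 2 * a ^ 2) := by
    intro a
    rcases Nat.eq_zero_or_pos K with hK0 | hK0
    · subst hK0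
      rw [eGradNormSq_fourierTruncate_shearState one_ne_zero zero_lt_one]
      exact zero_le
    · rw [CubicParityLoud.Negative.eGradNormSq_fourierTruncate_of_isLevel (isLevel_shearState one_ne_zero a hK0),
        eGradNormSq_shearState]
      simp
  have h0 : Torus.eGradNormSq (Torus.fourierTruncate K (((leakAtom m 0).1 : L2T3) :
      UnitAddTorus (Fin 3) → EuclideanSpace ℝ (Fin 3))) ≤ ENNReal.ofReal (Real.pi ^ 2 / 2) := by
    rw [leakAtom_zero]; refine (hlow _).trans_eq ?_; congr 1; ring
  have h1 : Torus.eGradNormSq (Torus.fourierTruncate K (((leakAtom m 1).1 : L2T3) :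
      UnitAddTorus (Fin 3) → EuclideanSpace ℝ (Fin 3))) ≤ ENNReal.ofReal (Real.pi ^ 2 / 8) := by
    rw [leakAtom_one]; refine (hlow _).trans_eq ?_; congr 1; ring
  have h2 : Torus.eGradNormSq (Torus.fourierTruncate K (((leakAtom m 2).1 : L2T3) :
      UnitAddTorus (Fin 3) → EuclideanSpace ℝ (Fin 3))) = 0 := by
    rw [leakAtom_two]; exact eGradNormSq_fourierTruncate_shearState _ hK _
  have h3 : Torus.eGradNormSq (Torus.fourierTruncate K (((leakAtom m 3).1 : L2T3) :
      UnitAddTorus (Fin 3) → EuclideanSpace ℝ (Fin 3))) ≤ 0 := by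
    rw [leakAtom_three]; refine (hlow _).trans_eq ?_; simp
  simp only [Fin.sum_univ_four, h2, mul_zero, add_zero]
  simp only [leakWeight, Matrix.cons_val_zero, Matrix.cons_val_one, Matrix.cons_val]
  have hA := (leakMassA_pos m).le
  have hC := (leakMassC_pos m).le
  calc ENNReal.ofReal (leakMassA m) * _ + ENNReal.ofReal (leakMassC m) * _ + ENNReal.ofReal (leakMass0 m) * _
      ≤ ENNReal.ofReal (leakMassA m) * ENNReal.ofReal (Real.pi ^ 2 / 2) +
          ENNReal.ofReal (leakMassC m) * ENNReal.ofReal (Real.pi ^ 2 / 8) + ENNReal.ofReal (leakMass0 m) * 0 := by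
        gcongr
    _ = ENNReal.ofReal (leakMassA m * (Real.pi ^ 2 / 2) + leakMassC m * (Real.pi ^ 2 / 8)) := by
        rw [mul_zero, add_zero, ← ENNReal.ofReal_mul hA, ← ENNReal.ofReal_mul hC,
          ← ENNReal.ofReal_add (by positivity) (by positivity)]

/-- **NO SCHEDULE RESOLVES THE LEAK FAMILY**: for every `κ`, the law at level `κ(0) + 2` violates the `n = 0` clause of
`IsResolved κ` (the cutoff quantum `π²/4 > 1 = (0+1)⁻¹` is invisible to `P_{κ 0}`). [folklore] -/
theorem not_isResolved_leakLaw (κ : ℕ → ℕ) : ¬ IsResolved κ (leakLaw (κ 0)) := by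
  intro h
  have h0 := h 0
  have hup := lintegral_eGradNormSq_fourierTruncate_leakLaw_le (κ 0) (K := κ 0) (by omega)
  have htot : ∫⁻ u, Torus.eGradNormSq ((u.1 : L2T3) : UnitAddTorus (Fin 3) → EuclideanSpace ℝ (Fin 3)) ∂(leakLaw (κ 0)) =
      ENNReal.ofReal (leakMassA (κ 0) * (Real.pi ^ 2 / 2) + leakMassC (κ 0) * (Real.pi ^ 2 / 8) + Real.pi ^ 2 / 4) :=
    ensembleEnstrophy_leakLaw (κ 0)
  rw [htot] at h0
  have h1 := h0.trans (add_le_add hup le_rfl)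
  simp only [Nat.cast_zero, zero_add, inv_one] at h1
  have hA := (leakMassA_pos (κ 0)).le
  have hC := (leakMassC_pos (κ 0)).le
  rw [← ENNReal.ofReal_one, ← ENNReal.ofReal_add (by positivity) zero_le_one,
    ENNReal.ofReal_le_ofReal_iff (by positivity)] at h1
  have h9 := pi_sq_gt_nine
  linarith

/-- … hence no `κ` resolves any family containing all the leak laws. [folklore] -/
theorem not_exists_isResolved_leakLaw {μ : ℕ → Measure (Torus.energySpace (Fin 3))} (hμ : ∀ m, μ (m + 2) = leakLaw m)
    (κ : ℕ → ℕ) : ¬ ∀ n, 2 ≤ n → IsResolved κ (μ n) := fun h =>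
  not_isResolved_leakLaw κ (by simpa [hμ] using h (κ 0 + 2) (by omega))

/-! ## 4. The barrier, stated -/

/-- **THE ROW BARRIER (data form).** For every `ν > 0` there are an admissible force and a family of laws `μ_n`
(every level `n ≥ 2`) which are probability laws carried by level-`n` fields in the unit ball, satisfy the ENERGY ROW
and the FGT ROW EXACTLY (hence carry the `N`-uniform weighted `H²` bound of S3 and a common mean-enstrophy bound `π²`),
are LOUD with `n`-uniform budgets (energy `≤ 1`, dissipation `≥ π²ν/4`) — and yet are NOT uniformly integrable in
enstrophy and NOT resolved by any schedule `κ`. [folklore] -/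
theorem rowBarrier {ν : ℝ} (hν : 0 < ν) :
    ∃ (f : UnitAddTorus (Fin 3) → EuclideanSpace ℝ (Fin 3)) (μ : ℕ → Measure (Torus.energySpace (Fin 3))),
      Torus.IsSmooth f ∧ Torus.IsDivFree f ∧ Torus.HasZeroMean f ∧
      (∀ n : ℕ, 2 ≤ n →
        IsProbabilityMeasure (μ n) ∧ (∀ᵐ u ∂(μ n), IsLevel n u) ∧ (∀ᵐ u ∂(μ n), ‖u‖ ≤ 1) ∧
        (Integrable (fun u => Torus.nsGeneratorPairing ν f u (trunc n u)) (μ n) ∧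
          ∫ u, Torus.nsGeneratorPairing ν f u (trunc n u) ∂(μ n) = 0) ∧
        IsFGTStationary ν f n (μ n) ∧
        Torus.ensembleEnergy (μ n) ≤ 1 ∧ Real.pi ^ 2 / 4 * ν ≤ Torus.ensembleDissipation ν (μ n) ∧
        Torus.ensembleEnstrophy (μ n) ≤ ENNReal.ofReal (Real.pi ^ 2)) ∧
      WeightedH2Bound 4 (Set.range fun m => μ (m + 2)) ∧
      ¬ UniformlyIntegrableEnstrophy (Set.range fun m => μ (m + 2)) ∧
      ∀ κ : ℕ → ℕ, ¬ ∀ n, 2 ≤ n → IsResolved κ (μ n) := by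
  refine ⟨leakForce ν, fun n => leakLaw (n - 2), isSmooth_leakForce ν, isDivFree_leakForce ν, hasZeroMean_leakForce ν,
    fun n hn => ?_, ?_, ?_, ?_⟩
  · obtain ⟨m, rfl⟩ : ∃ m, n = m + 2 := ⟨n - 2, by omega⟩
    simp only [Nat.add_sub_cancel]
    exact ⟨inferInstance, ae_isLevel_leakLaw m, ae_norm_le_leakLaw m, leakLaw_energyRow ν m, isFGTStationary_leakLaw ν m,
      ensembleEnergy_leakLaw_le m, ensembleDissipation_leakLaw_ge m hν.le, ensembleEnstrophy_leakLaw_le m⟩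
  · refine weightedH2Bound_four_of_fgt hν (isSmooth_leakForce ν) ?_
    rintro μ ⟨m, rfl⟩
    exact ⟨m + 2, by simpa using isFGTStationary_leakLaw ν m⟩
  · exact not_uniformlyIntegrableEnstrophy_leakLaw fun m => ⟨m, by simp⟩
  · exact not_exists_isResolved_leakLaw (fun m => by simp)


/-- **TIGHTNESS IN PROBABILITY DOES NOT UPGRADE TO UNIFORM INTEGRABILITY.** The leak family is FGT-stationary with the common
mean-enstrophy bound `π²`, hence (landed `tight_in_probability`, p89892) TIGHT IN PROBABILITY of its enstrophy spectrum and
(landed `weightedH2Bound_four_of_fgt`) carries `WeightedH2Bound 4` — and it is NOT uniformly integrable: the outputs of S1–S3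
plus the Chebyshev/tightness corollary do not reach S4. [folklore] -/
theorem tight_not_uniformlyIntegrable_leakLaw {ν : ℝ} (hν : 0 < ν) :
    (∀ η δ : ℝ≥0∞, 0 < η → 0 < δ → ∃ m : ℕ, ∀ μ ∈ Set.range leakLaw,
        μ {u | η ≤ Torus.tailGradNormSq m ((u.1 : L2T3) : UnitAddTorus (Fin 3) → EuclideanSpace ℝ (Fin 3))} ≤ δ) ∧
      WeightedH2Bound 4 (Set.range leakLaw) ∧
      (∀ μ ∈ Set.range leakLaw, Torus.ensembleEnstrophy μ ≤ ENNReal.ofReal (Real.pi ^ 2)) ∧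
      ¬ UniformlyIntegrableEnstrophy (Set.range leakLaw) := by
  have hfgt : ∀ μ ∈ Set.range leakLaw, ∃ N, IsFGTStationary ν (leakForce ν) N μ := by
    rintro μ ⟨m, rfl⟩
    exact ⟨m + 2, isFGTStationary_leakLaw ν m⟩
  have hmean : ∀ μ ∈ Set.range leakLaw, Torus.ensembleEnstrophy μ ≤ ENNReal.ofReal (Real.pi ^ 2) := by
    rintro μ ⟨m, rfl⟩
    exact ensembleEnstrophy_leakLaw_le m
  exact ⟨fun η δ hη hδ => MomentParityUniformResolution.tight_in_probability (leakForce ν) (isSmooth_leakForce ν) ν hν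
      (Set.range leakLaw) hfgt (ENNReal.ofReal (Real.pi ^ 2)) ENNReal.ofReal_ne_top hmean η δ hη hδ,
    weightedH2Bound_four_of_fgt hν (isSmooth_leakForce ν) hfgt, hmean,
    not_uniformlyIntegrableEnstrophy_leakLaw fun m => ⟨m, rfl⟩⟩

/-- The PER-FAMILY UPGRADE one might hope to prove for S4 from the rows in hand: "at fixed `ν > 0`, a family of loud level
laws in a ball satisfying the energy row and the FGT row is uniformly integrable in enstrophy". -/
def RowsForceUniformIntegrability : Prop :=
  ∀ (ν : ℝ), 0 < ν → ∀ f : UnitAddTorus (Fin 3) → EuclideanSpace ℝ (Fin 3),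
    Torus.IsSmooth f → Torus.IsDivFree f → Torus.HasZeroMean f →
    ∀ (R E ε : ℝ), 0 < ε → ∀ μ : ℕ → Measure (Torus.energySpace (Fin 3)),
    (∀ n : ℕ, 2 ≤ n → IsProbabilityMeasure (μ n) ∧ (∀ᵐ u ∂(μ n), IsLevel n u) ∧ (∀ᵐ u ∂(μ n), ‖u‖ ≤ R) ∧
      (Integrable (fun u => Torus.nsGeneratorPairing ν f u (trunc n u)) (μ n) ∧
        ∫ u, Torus.nsGeneratorPairing ν f u (trunc n u) ∂(μ n) = 0) ∧
      IsFGTStationary ν f n (μ n) ∧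
      Torus.ensembleEnergy (μ n) ≤ E ∧ ε ≤ Torus.ensembleDissipation ν (μ n)) →
    UniformlyIntegrableEnstrophy (Set.range fun m => μ (m + 2))

/-- The same upgrade with RESOLUTION (the crux's own conclusion clause) in place of uniform integrability. -/
def RowsForceResolution : Prop :=
  ∀ (ν : ℝ), 0 < ν → ∀ f : UnitAddTorus (Fin 3) → EuclideanSpace ℝ (Fin 3),
    Torus.IsSmooth f → Torus.IsDivFree f → Torus.HasZeroMean f →
    ∀ (R E ε : ℝ), 0 < ε → ∀ μ : ℕ → Measure (Torus.energySpace (Fin 3)),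
    (∀ n : ℕ, 2 ≤ n → IsProbabilityMeasure (μ n) ∧ (∀ᵐ u ∂(μ n), IsLevel n u) ∧ (∀ᵐ u ∂(μ n), ‖u‖ ≤ R) ∧
      (Integrable (fun u => Torus.nsGeneratorPairing ν f u (trunc n u)) (μ n) ∧
        ∫ u, Torus.nsGeneratorPairing ν f u (trunc n u) ∂(μ n) = 0) ∧
      IsFGTStationary ν f n (μ n) ∧
      Torus.ensembleEnergy (μ n) ≤ E ∧ ε ≤ Torus.ensembleDissipation ν (μ n)) →
    ∃ κ : ℕ → ℕ, ∀ n, 2 ≤ n → IsResolved κ (μ n)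

/-- **`¬ RowsForceUniformIntegrability`** — S4 `stub_loudUI` cannot be proved from the energy row and the FGT row (plus
loudness, ball, level): any proof must use rows on which the inertial term is visible. [folklore] -/
theorem not_rowsForceUniformIntegrability : ¬ RowsForceUniformIntegrability := fun h => by
  obtain ⟨f, μ, hfs, hfd, hfz, hfam, -, hUI, -⟩ := rowBarrier one_pos
  exact hUI (h 1 one_pos f hfs hfd hfz 1 1 (Real.pi ^ 2 / 4 * 1) (by positivity) μ fun n hn => by
    obtain ⟨h1, h2, h3, h4, h5, h6, h7, -⟩ := hfam n hn
    exact ⟨h1, h2, h3, h4, h5, h6, h7⟩)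

/-- **`¬ RowsForceResolution`** — nor can the crux's resolution clause. [folklore] -/
theorem not_rowsForceResolution : ¬ RowsForceResolution := fun h => by
  obtain ⟨f, μ, hfs, hfd, hfz, hfam, -, -, hres⟩ := rowBarrier one_pos
  obtain ⟨κ, hκ⟩ := h 1 one_pos f hfs hfd hfz 1 1 (Real.pi ^ 2 / 4 * 1) (by positivity) μ fun n hn => by
    obtain ⟨h1, h2, h3, h4, h5, h6, h7, -⟩ := hfam n hn
    exact ⟨h1, h2, h3, h4, h5, h6, h7⟩
  exact hres κ hκ

end Barrier

end

end Summit.AnomalousDissipation.AnomalousDissipation.Theorems.UniformResolution.Negative
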